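import Literature.MathematicalPhysics.QuantumFieldTheory.Balaban1983to89.T4MatchingClosureBirth

/-!
# `Balaban1983to89.T4YoungHosting` — THE HOSTING SUB-HISTORY OF A YOUNG POLYMER, PACKAGED: epoch tiling, the bank on
the model, and the ten per-polymer binders of seam (γ) as ONE structure (cell `pub-balaban`, node U5; record
`t4/T4-EST-U5E-rem.md` §2 D1 / §4 (unit `b2b-balaban-pv25`); journal self-row T4-U5.E-REM-HOSTING-K* 2026-08-19T07:16:14Z,
unit `b2b-balaban-pv25` gen 9 — NEW leaf module over unit pv02's seam (γ) `…T4MatchingClosureBirth` (p184379), which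
carries this lineage's `…T4EpochHorizon` v1.1 (p184243) / `…T4GeometricLedger` (p184102) and unit pv18's
`…T4GenealogyLifetime` v1.1 (p184458); modifies nothing)

HONEST FRAMING (cell `pub-balaban`, T4-DAG PAGE 1).  The cell's T4 target is the existence AND uniqueness of the
continuum limit of Bałaban's unit-scale averaged loop expectations on a finite torus — strictly beyond ultraviolet
stability ([Balaban1989LargeFieldII] Thm 1 p. 355); it is NOT infinite volume, NOT a mass gap, NOT the Clay problem.
This module is BOOKKEEPING ON THE CELL'S SIZE MODEL ONLY [folklore]: four definitions on a geometric genealogy ledger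
(`…T4GeometricLedger.GeoLedger`) and one-line compositions; 0 estimates.  NOTHING of [Balaban1989LargeFieldII],
[Balaban1988RG2Cluster] or [Balaban1987RG1] is asserted here: no quotation, no page claim, no `[cite:]` tag.  The printed
loci the model stands for (B16 pp. 384–387: the operation `S`, the chain (α)/(β), the enlargement inequality (γ) of
p. 385, the merge step (1.84)–(1.87) of p. 386, the horizon sentence «Thus K ≤ n₀ − j + R_j» of p. 385, the standing
cleanliness assumption of p. 384) are quoted — render-read — in the headers of `…B16SProfile`, `…B16MergeGeometry`,
`…B16StoppingRule`, `…T4SizeLedger`, `…T4Enlargement`; print ↔ model identifications are recorded in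
`t4/T4-EST-U5E-rem-ident.md` (unit b01).  Page numbers are LOCATIONS.

WHY THIS LEAF.  Seam (γ) (`…T4MatchingClosureBirth` §3: `window_of_geometric_stopping`, `stepBudget_of_twoRun_geometric`,
`steps_feed_of_twoRun_geometric`) feeds the young RATE clause of the node-U5 `StepBudget` from Lemma Y end to end
(`…T4EpochHorizon.lifetime_lt_youngWindow_of_geometric_stopping`), asking PER YOUNG DISCREPANT POLYMER for a geometric
genealogy ledger `G j Z` of its hosting sub-history together with TEN binders `hG h0 hc hDD hbk hbA hst hclean hstop hcover`
and three data families (`D j Z`, `bk j Z`, `st j Z`).  Its author's hand-off named them «pv25/pv18's OBJECT — when a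
producer theorem packages it, the pv02 side is ONE application of `stepBudget_of_twoRun_geometric`».  This leaf is that
packaging.  Five of the ten binders are not hypotheses at all once two pieces of the hosting sub-history's bookkeeping
are DEFINED on the model — its epoch tiling from the birth step, and its bank:
* §1 EPOCH TILING.  `epochStart G b i := b + Σ_{i′<i} steps (base i′)` — the epochs of the base lineage
  (`base 0 = base₀`, `base (e+1) = product e`) laid end to end from the birth step `b`; `MetAt G b j` — the polymer is
  met at step `j` DURING THE LAST EPOCH: `epochStart b E ≤ j ≤ epochStart b E + steps (base E)`.  THEN seam (γ)'s
  `hst` (`∀ i ≤ E, st i ≤ K`, with `st := epochStart G b`, from `j ≤ K`: `MetAt.hst`) and `hcover`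
  (`j ≤ b + Σ_{i ≤ E} steps (base i)`: `MetAt.hcover`, telescoping) are THEOREMS.
* §2 THE BANK ON THE MODEL (record §2 D1: `b(h) := c_e·p̄₀·m(h) + c_s·p̄₀²·D(h)`, `m` = number of events, `D` = Σ over the
  regions born into `h` of `(d′ + 1)`).  On a `GeoLedger`: `m ↦ E`; `D ↦ Dceil G := ⌈toLedger.Dtot⌉₊` — the booked birth
  mass `Σ_{booked regions}(treeLen + 1)` rounded up to an integer (`treeLen` is real-valued; seam (γ) types the mass bound
  `D j Z : ℕ`); `bank G c_e c_s p̄₀ := c_e·p̄₀·E + c_s·p̄₀²·Dceil` and, for the DOUBLED BOOKING `toLedger₂` that seam (γ)'s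
  producer consumes (`Dtot₂ = 2·Dtot`, `toLedger₂_Dtot`), `bank₂ G c_e c_s p̄₀ := c_e·p̄₀·E + c_s·p̄₀²·(2·Dceil)`;
  `BankYoung G … C′ K :↔ bank < c_e·p̄₀·ageCut C′ K`, `BankYoung₂` likewise.  THEN `hDD` (`Dtot₂ ≤ 2·Dceil`,
  `Dtot₂_le_two_Dceil`), `hbk` (`le_rfl`, `hbk_bank₂`) and `hbA` (`:= BankYoung₂`, by `Iff.rfl`) are discharged, and the OLD
  side READS `¬BankYoung₂ ↔ c_e·p̄₀·ageCut C′ K ≤ bank₂` (`not_bankYoung₂_iff`) with `bank₂ ≤ 2·bank`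
  (`bank₂_le_two_bank`): an old₂ sub-history has bank `≥ ½·c_e·p̄₀·A(K)` — the HYPOTHESIS SHAPE of NE7b-rem §0 (a)
  («sub-histories with b(h) ≥ B») at `B = ½·c_e p̄₀·A(K)`, i.e. the old-born factor `ρ^{A(K)}` with `ρ := e^{−c_e p̄₀/2}`
  (record §0 (f): «Any ρ < 1 serves the closure»; §6: constants only, none new in kind).  The undoubled reading with
  (P5₂) `2·c_e ≤ c_s·p̄₀` instead — bank `= bank` exactly, `ρ = e^{−c_e p̄₀}` — is §A.
* §3 `Hosts G b j Nsz Rw Clean : Prop` — THE HOSTING SUB-HISTORY AS ONE STRUCTURE: `Geometric`; the two combinatorial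
  sentences (`base₀ ∈ founded 0`, consumed lineages alive); `MetAt G b j`; cleanliness of every epoch
  (`Clean i l`, `1 ≤ l ≤ steps (base i)`); the STOPPING READING of every epoch with memory the typed (2.5) window AT THE
  EPOCH'S START SCALE, `Rw (epochStart G b i)`.  `step_le_birth_add_youngWindow_of_hosts` / `youngRate_of_hosts` =
  seam (γ) §1 BY NAME (`…T4MatchingClosureBirth.step_le_birth_add_youngWindow_of_geometric_stopping` /
  `youngRate_of_geometric_stopping`) for a `Hosts` instance that is `BankYoung₂` at a cutoff `K ≥ j`: `j ≤ b + youngWindow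
  d L₁ r (modelC d) C′ x̄ c̄ K` and `C_r·θ^b ≤ C_r·θ^j·θ^{−youngWindow … K}`, the remaining binders being the UNIFORM ones
  only (S-side constants with (P5), the flow of (I.0.20) up to `K` with its typed (2.5) windows and majorants, `Nsz ≥ 64`,
  `1 ≤ d`).
* §4 THE WINDOW LEVEL — seam (γ) §3 in ONE APPLICATION EACH: `window_of_hosts`, `stepBudget_of_twoRun_hosts` =
  `window_of_geometric_stopping` / `stepBudget_of_twoRun_geometric` with the ten per-polymer binders and the three data
  families REPLACED by `hhost : Young j Z → Hosts (G j Z) (birth j Z) j Nsz Rw (Clean j Z)` and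
  `hyb : Young j Z → BankYoung₂ (G j Z) c_e c_s p̄₀ C′ K` (`D := 2·Dceil`, `bk := bank₂`, `st := epochStart … (birth j Z)`);
  and the specialisation `Young j Z := BankYoung₂ (G j Z) c_e c_s p̄₀ C′ K` — `stepBudget_of_twoRun_bankYoung`,
  `steps_feed_of_twoRun_bankYoung` (`hyb := id`; the old-side binders `hsizeA hsizeB hQo` keyed to `¬BankYoung₂`, i.e. to
  «bank₂ ≥ c_e p̄₀·A(K)»; decidability classical — the conclusion does not mention it).
* §A THE UNDOUBLED BOOKING (suggested by unit pv18 gen 11 and by unit pv02 gen 13's cross-read of `…T4GenealogyLifetime`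
  v1.1): `treeLen_dom_base_le_σ₁` (`hZσ` for `toLedger`, with equality), `coverProfile_binders₁`,
  `lifetime_lt_of_geometric_four` := `…T4GenealogyLifetime.lifetime_lt_of_ledger_cover_four G.toLedger …` with
  `wf_of_geometric`, `hfnd_of_geometric`, `hev_of_geometric` BY NAME — Lemma Y end to end on the UNDOUBLED ledger with
  (P5₂) `2·c_e ≤ c_s·p̄₀` and `Dtot ≤ D`, next to `…T4GeometricLedger.GeoLedger.lifetime_lt_of_geometric` (doubled booking,
  (P5)); `lifetime_lt_youngWindow_of_geometric_stopping_four` (the (Y3) form, horizon discharged as in `…T4EpochHorizon`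
  §4); `step_le_birth_add_youngWindow_of_hosts_four` / `youngRate_of_hosts_four` (a `BankYoung` — undoubled bank —
  `Hosts` instance under (P5₂)).
  Placed here rather than as additive versions of `…T4GeometricLedger` / `…T4EpochHorizon` so that nothing is modified.
* §5 NON-VACUITY at `d = 1`: the test ledger `geoEx` of `…T4GeometricLedger` §4 (one founded cube, one event at once, all
  step counts `0`) `Hosts` a polymer met at its birth step with `Nsz = 64`, windows `Rw ≡ 1`, everything clean; its
  `Dceil = 2`, `bank 1 1 1 = 3`, `bank₂ 1 1 1 = 5 < 1·1·ageCut 10 1` (`…T4MatchingClosureBirth.six_lt_ageCut_ten_one`): it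
  is `BankYoung₂` at `C′ = 10`, `K = 1`, and §3 / §A are APPLIED to it with the flat flow (inhabitation of the joint
  hypothesis list; nothing about print).

WHAT REMAINS A BINDER / A READING (named, not hidden).  (i) THE HOSTING READING: that the sub-history hosting a young
polymer met at step `j` of a run IS a `Hosts (G j Z) (birth j Z) j Nsz Rw (Clean j Z)` instance — a `Geometric` genealogy
ledger (the reading (iii) of `…T4GeometricLedger`'s header: Q20 of the T4-DAG + the geometry of pp. 384–387), born at
`birth j Z`, its epochs laid end to end from the birth step and the polymer met during the last one (§1 is the DEFINITION
of that tiling, not a claim about print), each epoch clean (p. 384's standing assumption — a LOCATION) and stopped within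
its horizon by the stopping rule with memory the (2.5) window at its start scale (the STOPPING READING of
`…T4EpochHorizon`).  Print sums no histories and fixes no such data structure; the cell's records make the reading
explicit (`t4/T4-EST-U5E-rem.md` §4, `…-rem-ident.md`).  (ii) THE S-SIDE CONSTANTS `c_e, c_s, p̄₀` with (P5) (§A: (P5₂))
and the reading that the bank of §2 IS the combinatorial bank b(h) of record §2 D1 on the model (`m = E`, `D = ⌈Dtot⌉₊`;
[analysis], record §3 S1 / §6).  (iii) THE OLD SIDE: the bound `ρ^{A(K)}·(A e^{−R d})` for polymers that are NOT
`BankYoung₂` (binders `hsizeA`, `hsizeB` of §4) — NE7b-rem §0 (a) of the record ([analysis], NOT PRINTED as such; the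
printed (1.99)/(1.100) of p. 390 are the bank-free case and are LOCATIONS here), on the model normalisation of the bank
(§2: factor `½` in the exponent, constants only).  (iv) Everything seam (γ) itself leaves standing (the birth-step two-run
rate `hbirth`, the flow of (I.0.20) with its (2.5) windows, (1.26)_rel, the volume bound, locality, the KP smallness, the
cube counts, `hRem`) is a binder here verbatim.  No `StepBudget` is INSTANTIATED for Bałaban's objects: as in seams
(β)/(γ), it is built from abstract binders over abstract types `Dom`, `Cube` and abstract activities (cell ABSOLUTE RULE).

ABSOLUTE RULE.  NOTHING of [Balaban 1983–89] is quoted as authority or asserted here; no display is transcribed; no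
programme-internal claim is cited; no `[cite:]` tag; page numbers are LOCATIONS.  Every declaration is [folklore]
bookkeeping over `…T4GeometricLedger`, `…T4EpochHorizon` §4, `…T4GenealogyLifetime` §4b and `…T4MatchingClosureBirth`
§1/§3.

DICTIONARY.  As in `…T4MatchingClosureBirth` (steps `j` of the window `Icc (jlogOf C K) K`; catalogues `Cat j ⊇ Disc j`;
activities `wA j`, `wB j`; the age predicate `Young j`; `birth j Z`; `G j Z : GeoLedger dd κ η`; ONE flow `F` per cutoff with
typed (2.5) windows `Rw` and majorants `β′, x̄, c̄`; S-side constants `c_e, c_s, p̄₀`; `Nsz`), plus: `epochStart G b i` = the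
start scale of epoch `i` of a sub-history born at step `b`; `MetAt G b j`; `Dceil G`, `bank G`, `bank₂ G`, `BankYoung G`,
`BankYoung₂ G`; `Hosts G b j Nsz Rw Clean`.  In §1–§3, §A, §5 the lattice dimension is `d` and the region type `ι` (as in
`…T4GeometricLedger`); in §4 they are `dd` and `η`, because seam (β) uses `d` for its size function and `ι` for its
incompatibility relation (as in `…T4MatchingClosureBirth`).

CONTENTS.  §1 `epochStart`, `epochStart_zero/_succ/_mono`, `le_epochStart`, `epochStart_succ_E`, `MetAt`,
`MetAt.birth_le/le_birth_add_lifetime/hcover/hst`.  §2 `Dceil`, `Dtot_le_Dceil`, `toLedger₂_f`, `toLedger₂_Dtot`,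
`Dtot₂_le_two_Dceil`, `bank`, `bank₂`, `hbk_bank`, `hbk_bank₂`, `bank_le_bank₂`, `bank₂_le_two_bank`, `BankYoung`,
`BankYoung₂`, `bankYoung_of_bankYoung₂`, `not_bankYoung_iff`, `not_bankYoung₂_iff`,
`threshold_le_two_bank_of_not_bankYoung₂`.  §3 `Hosts`, `step_le_birth_add_youngWindow_of_hosts`, `youngRate_of_hosts`.
§4 `window_of_hosts`, `stepBudget_of_twoRun_hosts`, `stepBudget_of_twoRun_bankYoung`, `steps_feed_of_twoRun_bankYoung`.
§A `treeLen_dom_base_le_σ₁`, `coverProfile_binders₁`, `lifetime_lt_of_geometric_four`,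
`lifetime_lt_youngWindow_of_geometric_stopping_four`, `step_le_birth_add_youngWindow_of_hosts_four`,
`youngRate_of_hosts_four`.  §5 non-vacuity (`epochStart_geoEx`, `metAt_geoEx`, `hosts_geoEx`, `Dtot_geoEx`, `Dceil_geoEx`,
`bank_geoEx`, `bank₂_geoEx`, `bank_geoEx₂`, `bankYoung₂_geoEx`, `bankYoung_geoEx`, `bankYoung_geoEx₂`; §3, §A applied).

Value = the per-polymer hypothesis list of the node-U5 young-rate feed reduced, by definitions on the MODEL, from ten
binders and three data families to ONE hosting structure and ONE bank inequality per young polymer; NOT an estimate, NOT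
summit progress.  Rung (B)+1 (finite `T⁴`), NOT continuum, NOT Clay.  Unit `b2b-balaban-pv25` gen 9.
-/

open Finset

namespace Literature.MathematicalPhysics.QuantumFieldTheory.Balaban1983to89.T4YoungHosting

open Literature.MathematicalPhysics.QuantumFieldTheory.Balaban1983to89

noncomputable section

/-! ## §1 The epoch tiling of a sub-history born at step `b`; seam (γ)'s `hst`, `hcover` as theorems -/

section Tiling

open T4GeometricLedger

variable {d : ℕ} {κ ι : Type*} (G : GeoLedger d κ ι)

/-- START SCALE OF EPOCH `i` of a sub-history born at step `b`: the epochs of the base lineage laid end to end,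
`b + Σ_{i′ < i} steps (base i′)` (a DEFINITION of the model's tiling; print fixes no such bookkeeping). [folklore] -/
def epochStart (b i : ℕ) : ℕ := b + ∑ i' ∈ Finset.range i, G.steps (G.base i')

/-- Epoch `0` starts at the birth step. [folklore] -/
@[simp] theorem epochStart_zero (b : ℕ) : epochStart G b 0 = b := by simp [epochStart]

/-- Epoch `i+1` starts where epoch `i` ends. [folklore] -/
theorem epochStart_succ (b i : ℕ) : epochStart G b (i + 1) = epochStart G b i + G.steps (G.base i) := by
  unfold epochStart
  rw [Finset.sum_range_succ, Nat.add_assoc]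

/-- Start scales increase along the sub-history. [folklore] -/
theorem epochStart_mono (b : ℕ) {i i' : ℕ} (h : i ≤ i') : epochStart G b i ≤ epochStart G b i' := by
  unfold epochStart
  exact Nat.add_le_add_left (Finset.sum_le_sum_of_subset (Finset.range_mono h)) b

/-- Every epoch starts at or after the birth step. [folklore] -/
theorem le_epochStart (b i : ℕ) : b ≤ epochStart G b i := Nat.le_add_right _ _

/-- The end of the last epoch is the birth step plus the total lifetime `Σ_{i ≤ E} steps (base i)`. [folklore] -/
theorem epochStart_succ_E (b : ℕ) :
    epochStart G b G.E + G.steps (G.base G.E) = b + ∑ i ∈ Finset.range (G.E + 1), G.steps (G.base i) := by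
  rw [← epochStart_succ]; rfl

/-- MET AT STEP `j`: the polymer is met during the LAST epoch of its hosting sub-history born at step `b` —
`epochStart b E ≤ j ≤ epochStart b E + steps (base E)`. [folklore] -/
def MetAt (b j : ℕ) : Prop := epochStart G b G.E ≤ j ∧ j ≤ epochStart G b G.E + G.steps (G.base G.E)

variable {G}

/-- A polymer is met at or after the birth step of its hosting sub-history. [folklore] -/
theorem MetAt.birth_le {b j : ℕ} (h : MetAt G b j) : b ≤ j := (le_epochStart G b G.E).trans h.1

/-- The meeting step is within the lifetime of the sub-history from its birth. [folklore] -/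
theorem MetAt.le_birth_add_lifetime {b j : ℕ} (h : MetAt G b j) :
    j ≤ b + ∑ i ∈ Finset.range (G.E + 1), G.steps (G.base i) := by
  rw [← epochStart_succ_E G b]; exact h.2

/-- **SEAM (γ)'s BINDER `hcover` AS A THEOREM**: `j ≤ b + Σ_{i ≤ E} steps (base i)` in the real form of
`…T4MatchingClosureBirth.step_le_birth_add_youngWindow_of_geometric_stopping`. [folklore] -/
theorem MetAt.hcover {b j : ℕ} (h : MetAt G b j) :
    (j : ℝ) ≤ b + ∑ i ∈ Finset.range (G.E + 1), ((G.steps (G.base i) : ℕ) : ℝ) := by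
  exact_mod_cast h.le_birth_add_lifetime

/-- **SEAM (γ)'s BINDER `hst` AS A THEOREM**: at a cutoff `K ≥ j` every epoch starts at a scale `≤ K`
(`st := epochStart G b`). [folklore] -/
theorem MetAt.hst {b j K : ℕ} (h : MetAt G b j) (hjK : j ≤ K) : ∀ i, i ≤ G.E → epochStart G b i ≤ K :=
  fun _ hi => ((epochStart_mono G b hi).trans h.1).trans hjK

end Tiling

/-! ## §2 The bank on the model; seam (γ)'s `hDD`, `hbk`, `hbA` discharged; the old-side reading -/

section Bank

open T4GeometricLedger T4RemnantBooking

variable {d : ℕ} {κ ι : Type*} (G : GeoLedger d κ ι)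

/-- BOOKED BIRTH MASS, ROUNDED UP: `⌈Dtot⌉₊` of the undoubled numerical ledger — on the model, record §2 D1's
`D(h) = Σ_{regions born into h}(d′ + 1)` (`Dtot = Σ_{booked regions}(treeLen + 1)`, real-valued). [folklore] -/
def Dceil : ℕ := ⌈G.toLedger.Dtot⌉₊

/-- `Dtot ≤ Dceil`. [folklore] -/
theorem Dtot_le_Dceil : G.toLedger.Dtot ≤ (Dceil G : ℝ) := Nat.le_ceil _

/-- The doubled booking doubles every booked birth mass. [folklore] -/
theorem toLedger₂_f (i : ℕ) : G.toLedger₂.f i = 2 * G.toLedger.f i := by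
  cases i with
  | zero => simp [Finset.mul_sum]
  | succ e =>
    by_cases he : e < G.E
    · rw [G.toLedger₂.f_succ_of_lt (by simpa using he), G.toLedger.f_succ_of_lt (by simpa using he)]
      simp [Finset.mul_sum, mul_add]
    · rw [G.toLedger₂.f_succ_of_le (by simpa using not_lt.1 he), G.toLedger.f_succ_of_le (by simpa using not_lt.1 he)]
      simp

/-- `Dtot₂ = 2·Dtot` (the price line of `…T4GeometricLedger` §5, as an equation). [folklore] -/
theorem toLedger₂_Dtot : G.toLedger₂.Dtot = 2 * G.toLedger.Dtot := by
  simp only [T4Genealogy.Ledger.Dtot, GeoLedger.toLedger₂_E, GeoLedger.toLedger_E, toLedger₂_f, Finset.mul_sum]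

/-- **SEAM (γ)'s BINDER `hDD` DISCHARGED**: `Dtot₂ ≤ 2·Dceil` (`D j Z := 2·Dceil (G j Z)`). [folklore] -/
theorem Dtot₂_le_two_Dceil : G.toLedger₂.Dtot ≤ ((2 * Dceil G : ℕ) : ℝ) := by
  rw [toLedger₂_Dtot]; push_cast; linarith [Dtot_le_Dceil G]

/-- THE BANK OF THE SUB-HISTORY ON THE MODEL (record §2 D1, `b(h) := c_e·p̄₀·m(h) + c_s·p̄₀²·D(h)`, with `m ↦ E`,
`D ↦ Dceil`). [folklore] -/
def bank (ce cs p₀ : ℝ) : ℝ := ce * p₀ * G.E + cs * p₀ ^ 2 * (Dceil G : ℝ)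

/-- THE BANK READ ON THE DOUBLED BOOKING (`D ↦ 2·Dceil`): the bank seam (γ)'s producer
(`…T4EpochHorizon.lifetime_lt_youngWindow_of_geometric_stopping`, doubled ledger `toLedger₂`, (P5)) compares with the
age-cut credit. [folklore] -/
def bank₂ (ce cs p₀ : ℝ) : ℝ := ce * p₀ * G.E + cs * p₀ ^ 2 * ((2 * Dceil G : ℕ) : ℝ)

/-- `hbk` for the undoubled bank (§A), by `le_rfl`. [folklore] -/
theorem hbk_bank (ce cs p₀ : ℝ) : ce * p₀ * G.E + cs * p₀ ^ 2 * (Dceil G : ℝ) ≤ bank G ce cs p₀ := le_rfl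

/-- **SEAM (γ)'s BINDER `hbk` DISCHARGED** (`bk j Z := bank₂ (G j Z) c_e c_s p̄₀`), by `le_rfl`. [folklore] -/
theorem hbk_bank₂ (ce cs p₀ : ℝ) : ce * p₀ * G.E + cs * p₀ ^ 2 * ((2 * Dceil G : ℕ) : ℝ) ≤ bank₂ G ce cs p₀ := le_rfl

/-- `bank ≤ bank₂` (`c_s ≥ 0`). [folklore] -/
theorem bank_le_bank₂ {ce cs p₀ : ℝ} (hcs : 0 ≤ cs) : bank G ce cs p₀ ≤ bank₂ G ce cs p₀ := by
  unfold bank bank₂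
  have h : cs * p₀ ^ 2 * (Dceil G : ℝ) ≤ cs * p₀ ^ 2 * ((2 * Dceil G : ℕ) : ℝ) :=
    mul_le_mul_of_nonneg_left (by push_cast; linarith [(Nat.cast_nonneg (Dceil G) : (0 : ℝ) ≤ Dceil G)])
      (by positivity)
  linarith

/-- `bank₂ ≤ 2·bank` (`c_e·p̄₀ ≥ 0`): the doubled reading costs at most a factor `2`. [folklore] -/
theorem bank₂_le_two_bank {ce cs p₀ : ℝ} (hce : 0 ≤ ce * p₀) : bank₂ G ce cs p₀ ≤ 2 * bank G ce cs p₀ := by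
  unfold bank bank₂
  have h : 0 ≤ ce * p₀ * (G.E : ℝ) := mul_nonneg hce (Nat.cast_nonneg _)
  push_cast
  linarith

/-- BANK-YOUNG AT CUTOFF `K` (undoubled bank): `bank < c_e·p̄₀·ageCut C′ K` — the bank is below the age-cut credit
(record §0 (c), bank age: «b(h) < c_e p̄₀ A»). [folklore] -/
def BankYoung (ce cs p₀ C' : ℝ) (K : ℕ) : Prop := bank G ce cs p₀ < ce * p₀ * ageCut C' K

/-- BANK-YOUNG AT CUTOFF `K` ON THE DOUBLED BOOKING: `bank₂ < c_e·p̄₀·ageCut C′ K` — **SEAM (γ)'s BINDER `hbA`** is this,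
by `Iff.rfl`, once `Young j Z → BankYoung₂ (G j Z) …`. [folklore] -/
def BankYoung₂ (ce cs p₀ C' : ℝ) (K : ℕ) : Prop := bank₂ G ce cs p₀ < ce * p₀ * ageCut C' K

variable {G}

/-- Young on the doubled booking ⇒ young. [folklore] -/
theorem bankYoung_of_bankYoung₂ {ce cs p₀ C' : ℝ} {K : ℕ} (hcs : 0 ≤ cs) (h : BankYoung₂ G ce cs p₀ C' K) :
    BankYoung G ce cs p₀ C' K :=
  (bank_le_bank₂ G hcs).trans_lt h

/-- THE OLD SIDE READS «bank ≥ threshold» (the hypothesis shape of NE7b-rem §0 (a), `B = c_e p̄₀·A(K)`). [folklore] -/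
theorem not_bankYoung_iff {ce cs p₀ C' : ℝ} {K : ℕ} :
    ¬BankYoung G ce cs p₀ C' K ↔ ce * p₀ * ageCut C' K ≤ bank G ce cs p₀ :=
  not_lt

/-- The old side on the doubled booking: «bank₂ ≥ threshold». [folklore] -/
theorem not_bankYoung₂_iff {ce cs p₀ C' : ℝ} {K : ℕ} :
    ¬BankYoung₂ G ce cs p₀ C' K ↔ ce * p₀ * ageCut C' K ≤ bank₂ G ce cs p₀ :=
  not_lt

/-- An old₂ sub-history has (undoubled) bank `≥ ½·c_e·p̄₀·A(K)`: the old-born smallness of NE7b-rem §0 (a) is asked at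
`B = ½·c_e p̄₀·A(K)`, i.e. with `ρ := e^{−c_e p̄₀/2}` (constants only). [folklore] -/
theorem threshold_le_two_bank_of_not_bankYoung₂ {ce cs p₀ C' : ℝ} {K : ℕ} (hce : 0 ≤ ce * p₀)
    (h : ¬BankYoung₂ G ce cs p₀ C' K) : ce * p₀ * ageCut C' K ≤ 2 * bank G ce cs p₀ :=
  (not_bankYoung₂_iff.1 h).trans (bank₂_le_two_bank G hce)

end Bank

/-! ## §3 The hosting sub-history as one structure; seam (γ) §1 for it, by name -/

section Hosting

open B16SProfile B16StoppingRule T4GeometricLedger T4RemnantBooking T4BankAgeYoung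

variable {d : ℕ} {κ ι : Type*} [DecidableEq κ]

/-- **THE HOSTING SUB-HISTORY OF A POLYMER MET AT STEP `j`, BORN AT STEP `b`** — the per-polymer content of seam (γ)'s
binders as ONE proposition on a geometric genealogy ledger: the geometric sentences (`Geometric`); the two combinatorial
sentences; the epoch tiling from `b` meets `j` in the last epoch (`MetAt`); every epoch is clean on its steps; the
STOPPING READING of every epoch, the stopping rule's memory being the typed (2.5) window `Rw` at the epoch's start scale
`epochStart G b i`.  (The READING that a printed sub-history is such an instance is the standing binder (i) of the module
docstring; nothing printed is asserted.) [folklore] -/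
structure Hosts (G : GeoLedger d κ ι) (b j Nsz : ℕ) (Rw : ℕ → ℕ) (Clean : ℕ → ℕ → Prop) : Prop where
  /-- the geometric sentences of `…T4GeometricLedger` [folklore] -/
  geometric : G.Geometric
  /-- the creation lineage is founded in epoch `0` [folklore] -/
  founded₀ : G.base₀ ∈ G.founded 0
  /-- events consume alive lineages [folklore] -/
  consumed_alive : ∀ e, e < G.E → G.consumed e ⊆ G.toLedger.alive e
  /-- the polymer is met at step `j` during the last epoch of the tiling from `b` [folklore] -/
  metAt : MetAt G b j
  /-- every epoch is clean on its steps (p. 384's standing assumption, a LOCATION) [folklore] -/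
  clean : ∀ i, i ≤ G.E → ∀ l, 1 ≤ l → l ≤ G.steps (G.base i) → Clean i l
  /-- the STOPPING READING: epoch `i` does not outlast an index within its horizon at which `S^{·}(dom (base i))` has the
  stopping property with memory `Rw (epochStart G b i)` [folklore] -/
  stop : ∀ i, i ≤ G.E → ∀ K', K' ≤ G.steps (G.base i) →
    StopAt Nsz (Rw (epochStart G b i)) (Clean i) (fun n => Siter (ratio G.L (G.expo (G.base i))) n (G.dom (G.base i)))
      K' → G.steps (G.base i) ≤ K'

variable [DecidableEq ι]

/-- **THE WINDOW CLAUSE OF ONE HOSTED BANK-YOUNG POLYMER** (`…T4MatchingClosureBirth.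
step_le_birth_add_youngWindow_of_geometric_stopping` BY NAME, its per-sub-history binders `hst`, `hcover` supplied by §1
and `hDD`, `hbk`, `hbA` by §2): a polymer met at step `j ≤ K`, hosted by a sub-history born at `b` that is `BankYoung₂` at
the cutoff `K`, satisfies `j ≤ b + youngWindow d L₁ r (modelC d) C′ x̄ c̄ K`; the remaining hypotheses are the UNIFORM
ones (S-side constants with (P5), ONE flow up to `K` with its typed (2.5) windows and majorants, `Nsz ≥ 64`, `1 ≤ d`).
[folklore] -/
theorem step_le_birth_add_youngWindow_of_hosts {G : GeoLedger d κ ι} {b j Nsz : ℕ} {Rw : ℕ → ℕ}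
    {Clean : ℕ → ℕ → Prop} (h : Hosts G b j Nsz Rw Clean) (hd : 1 ≤ d) {K : ℕ} (hjK : j ≤ K)
    {ce cs p₀ C' : ℝ} (hce : 0 < ce) (hp : 0 < p₀) (hP5 : ce ≤ cs * p₀) (hy : BankYoung₂ G ce cs p₀ C' K)
    (F : Flow) {β' : ℝ} (hβ' : 0 ≤ β') {L₁ r : ℕ} (hL : 1 ≤ L₁)
    (hpos : ∀ j, j ≤ K → 0 < F.g j) (hle1 : ∀ j, j ≤ K → F.g j ≤ 1) (hrg : F.SatisfiesRG K)
    (hub : ∀ j, j < K → F.β (j + 1) (F.g j) ≤ β') (hRj : ∀ j, j ≤ K → B14.IsRj L₁ r (F.g j) (Rw j))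
    {x c : ℝ} (hx : 0 ≤ x) (hcc : 0 ≤ c) (hxK : Real.log ((F.g K) ^ 2)⁻¹ ≤ x) (hcK : (F.g K) ^ 2 * β' ≤ c)
    (hNsz : 64 ≤ Nsz) :
    j ≤ b + youngWindow d L₁ r (T4EpochSize.modelC d) C' x c K :=
  T4MatchingClosureBirth.step_le_birth_add_youngWindow_of_geometric_stopping G h.geometric h.founded₀ h.consumed_alive hd
    (Dtot₂_le_two_Dceil G) hce hp hP5 (hbk_bank₂ G ce cs p₀) hy F hβ' hL hpos hle1 hrg hub Rw hRj hx hcc hxK hcK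
    (h.metAt.hst hjK) hNsz Clean h.clean h.stop h.metAt.hcover

/-- **THE YOUNG RATE OF ONE HOSTED BANK-YOUNG POLYMER** (`…T4MatchingClosureBirth.youngRate_of_geometric_stopping` BY
NAME; `0 < θ ≤ 1`, `0 ≤ C_r`): `C_r·θ^b ≤ C_r·θ^j·θ^{−youngWindow d L₁ r (modelC d) C′ x̄ c̄ K}`. [folklore] -/
theorem youngRate_of_hosts {θ : ℝ} (hθ : 0 < θ) (hθ1 : θ ≤ 1) {Cr : ℝ} (hCr : 0 ≤ Cr)
    {G : GeoLedger d κ ι} {b j Nsz : ℕ} {Rw : ℕ → ℕ}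
    {Clean : ℕ → ℕ → Prop} (h : Hosts G b j Nsz Rw Clean) (hd : 1 ≤ d) {K : ℕ} (hjK : j ≤ K)
    {ce cs p₀ C' : ℝ} (hce : 0 < ce) (hp : 0 < p₀) (hP5 : ce ≤ cs * p₀) (hy : BankYoung₂ G ce cs p₀ C' K)
    (F : Flow) {β' : ℝ} (hβ' : 0 ≤ β') {L₁ r : ℕ} (hL : 1 ≤ L₁)
    (hpos : ∀ j, j ≤ K → 0 < F.g j) (hle1 : ∀ j, j ≤ K → F.g j ≤ 1) (hrg : F.SatisfiesRG K)
    (hub : ∀ j, j < K → F.β (j + 1) (F.g j) ≤ β') (hRj : ∀ j, j ≤ K → B14.IsRj L₁ r (F.g j) (Rw j))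
    {x c : ℝ} (hx : 0 ≤ x) (hcc : 0 ≤ c) (hxK : Real.log ((F.g K) ^ 2)⁻¹ ≤ x) (hcK : (F.g K) ^ 2 * β' ≤ c)
    (hNsz : 64 ≤ Nsz) :
    Cr * θ ^ b ≤ Cr * θ ^ j * θ⁻¹ ^ youngWindow d L₁ r (T4EpochSize.modelC d) C' x c K :=
  T4MatchingClosureBirth.youngRate_of_geometric_stopping hθ hθ1 hCr G h.geometric h.founded₀ h.consumed_alive hd
    (Dtot₂_le_two_Dceil G) hce hp hP5 (hbk_bank₂ G ce cs p₀) hy F hβ' hL hpos hle1 hrg hub Rw hRj hx hcc hxK hcK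
    (h.metAt.hst hjK) hNsz Clean h.clean h.stop h.metAt.hcover

end Hosting

/-! ## §4 The window level: seam (γ) §3 in one application each -/

section Window

open T4GoodClassBudget T4RemnantBooking T4BankAgeYoung

variable {Dom : Type*} {dd : ℕ} {κ η : Type*} [DecidableEq κ] [DecidableEq η]

/-- **THE WINDOW CLAUSE DISCHARGED ON THE WINDOW FROM HOSTED BANK-YOUNG POLYMERS**
(`…T4MatchingClosureBirth.window_of_geometric_stopping` in ONE application): if every young discrepant polymer
`Z ∈ Disc j`, `j ∈ [jlog_C K, K]`, is hosted (`Hosts (G j Z) (birth j Z) j Nsz Rw (Clean j Z)`) and `BankYoung₂` at `K`,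
then `j ≤ birth j Z + youngWindow dd L₁ r (modelC dd) C′ x̄ c̄ K` — seam (γ)'s ten per-polymer binders and three data
families replaced by `hhost` and `hyb` (`D := 2·Dceil`, `bk := bank₂`, `st := epochStart (G j Z) (birth j Z)`).
Uniform binders verbatim. [folklore] -/
theorem window_of_hosts {C C' : ℝ} {K : ℕ} {Disc : ℕ → Finset Dom} (Young : ℕ → Dom → Prop)
    (birth : ℕ → Dom → ℕ) (hdd : 1 ≤ dd) (G : ℕ → Dom → T4GeometricLedger.GeoLedger dd κ η)
    {ce cs p₀ : ℝ} (hce : 0 < ce) (hp : 0 < p₀) (hP5 : ce ≤ cs * p₀)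
    (F : Flow) {β' : ℝ} (hβ' : 0 ≤ β') {L₁ r : ℕ} (hL : 1 ≤ L₁)
    (hpos : ∀ j, j ≤ K → 0 < F.g j) (hle1 : ∀ j, j ≤ K → F.g j ≤ 1) (hrg : F.SatisfiesRG K)
    (hub : ∀ j, j < K → F.β (j + 1) (F.g j) ≤ β') (Rw : ℕ → ℕ)
    (hRj : ∀ j, j ≤ K → B14.IsRj L₁ r (F.g j) (Rw j))
    {x c : ℝ} (hx : 0 ≤ x) (hcc : 0 ≤ c) (hxK : Real.log ((F.g K) ^ 2)⁻¹ ≤ x) (hcK : (F.g K) ^ 2 * β' ≤ c)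
    {Nsz : ℕ} (hNsz : 64 ≤ Nsz) (Clean : ℕ → Dom → ℕ → ℕ → Prop)
    (hhost : ∀ j ∈ Icc (jlogOf C K) K, ∀ Z ∈ Disc j, Young j Z → Hosts (G j Z) (birth j Z) j Nsz Rw (Clean j Z))
    (hyb : ∀ j ∈ Icc (jlogOf C K) K, ∀ Z ∈ Disc j, Young j Z → BankYoung₂ (G j Z) ce cs p₀ C' K) :
    ∀ j ∈ Icc (jlogOf C K) K, ∀ Z ∈ Disc j, Young j Z →
      j ≤ birth j Z + youngWindow dd L₁ r (T4EpochSize.modelC dd) C' x c K :=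
  T4MatchingClosureBirth.window_of_geometric_stopping Young birth hdd G
    (fun j hj Z hZ hY => (hhost j hj Z hZ hY).geometric) (fun j hj Z hZ hY => (hhost j hj Z hZ hY).founded₀)
    (fun j hj Z hZ hY => (hhost j hj Z hZ hY).consumed_alive) (D := fun j Z => 2 * Dceil (G j Z))
    (fun j _ Z _ _ => Dtot₂_le_two_Dceil (G j Z)) (bk := fun j Z => bank₂ (G j Z) ce cs p₀) hce hp hP5
    (fun j _ Z _ _ => hbk_bank₂ (G j Z) ce cs p₀) hyb F hβ' hL hpos hle1 hrg hub Rw hRj hx hcc hxK hcK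
    (st := fun j Z i => epochStart (G j Z) (birth j Z) i)
    (fun j hj Z hZ hY => (hhost j hj Z hZ hY).metAt.hst (Finset.mem_Icc.1 hj).2) hNsz Clean
    (fun j hj Z hZ hY => (hhost j hj Z hZ hY).clean) (fun j hj Z hZ hY => (hhost j hj Z hZ hY).stop)
    (fun j hj Z hZ hY => (hhost j hj Z hZ hY).metAt.hcover)

end Window

section WindowTwoRun

open Literature.Probability.LatticeModels
open B13FamilySum B16Exp198 B16Exp198TwoRun T4NestedLevels T4RemnantBooking T4GoodClassBudget T4MatchingClosureRem
  T4MatchingClosureFed T4TwoRunRateAssembly T4MatchingClosureTwoRun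

variable {Dom Cube : Type*} [DecidableEq Dom] [DecidableEq Cube]
variable (ι : Dom → Dom → Prop) [DecidableRel ι]
variable {dd : ℕ} {κ η : Type*} [DecidableEq κ] [DecidableEq η]

/-- **`StepBudget` AT THE CANONICAL YOUNG WINDOW FROM BIRTH-STEP RATES AND HOSTED BANK-YOUNG POLYMERS**
(`…T4MatchingClosureBirth.stepBudget_of_twoRun_geometric` in ONE application): seam (γ)'s end-to-end theorem with its ten
per-polymer producer binders (`hG h0 hc hDD hbk hbA hst hclean hstop hcover`) and three data families (`D, bk, st`)
REPLACED by `hhost` (each young discrepant polymer is hosted: `Hosts (G j Z) (birth j Z) j Nsz Rw (Clean j Z)`) and `hyb`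
(`BankYoung₂ (G j Z) c_e c_s p̄₀ C′ K`).  Every other binder of seam (γ) verbatim; `StepBudget` is instantiated from
abstract binders only; nothing PRINTED is asserted. [folklore] -/
theorem stepBudget_of_twoRun_hosts [Fintype Dom] [Std.Refl ι] [Std.Symm ι]
    {C C' θ ρ Cr vol Λ : ℝ} {K : ℕ} (hθ : 0 < θ) (hθ1 : θ ≤ 1) (hCr : 0 ≤ Cr)
    {Cat Disc : ℕ → Finset Dom} (hDisc : ∀ j, Disc j ⊆ Cat j)
    {cubes out reach : ℕ → Dom → Finset Cube} {d : ℕ → Dom → ℝ} {wA wB : ℕ → Dom → ℂ}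
    {A R r₁ s κ₀ K₀ c₁ b τ ν : ℝ}
    (hloc : ∀ j Z, ∀ Z' ∈ Cat j, ι Z' Z → ∃ q ∈ reach j Z, q ∈ out j Z')
    (hreach : ∀ j Z, ((reach j Z).card : ℝ) ≤ ν * (out j Z).card)
    (hd : ∀ j Z, 0 ≤ d j Z) (hA : 0 ≤ A) (hK₀ : 0 ≤ K₀) (hτ : 0 ≤ τ) (hρ : 0 ≤ ρ)
    (hr₁ : 0 ≤ r₁) (hs : 0 ≤ s) (hb : 0 ≤ b)
    (hwAΛ : ∀ j Z, Z ∉ Cat j → wA j Z = 0) (hwBΛ : ∀ j Z, Z ∉ Cat j → wB j Z = 0)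
    (hwA : ∀ j Z, ‖wA j Z‖ ≤ A * Real.exp (-(R * d j Z)))
    (hwB : ∀ j Z, ‖wB j Z‖ ≤ A * Real.exp (-(R * d j Z)))
    (hzero : ∀ j, ∀ Z ∈ Cat j, Z ∉ Disc j → wA j Z = wB j Z)
    (Young : ℕ → Dom → Prop) [∀ j, DecidablePred (Young j)] (birth : ℕ → Dom → ℕ)
    (hbirth : ∀ j ∈ Icc (jlogOf C K) K, ∀ Z ∈ Disc j, Young j Z →
      ‖wA j Z - wB j Z‖ ≤ Cr * θ ^ birth j Z * (A * Real.exp (-(R * d j Z))))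
    (hdd : 1 ≤ dd) (G : ℕ → Dom → T4GeometricLedger.GeoLedger dd κ η)
    {ce cs p₀ : ℝ} (hce : 0 < ce) (hp : 0 < p₀) (hP5 : ce ≤ cs * p₀)
    (F : Flow) {β' : ℝ} (hβ' : 0 ≤ β') {L₁ r : ℕ} (hL : 1 ≤ L₁)
    (hpos : ∀ j, j ≤ K → 0 < F.g j) (hle1 : ∀ j, j ≤ K → F.g j ≤ 1) (hrg : F.SatisfiesRG K)
    (hub : ∀ j, j < K → F.β (j + 1) (F.g j) ≤ β') (Rw : ℕ → ℕ)
    (hRj : ∀ j, j ≤ K → B14.IsRj L₁ r (F.g j) (Rw j))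
    {x c : ℝ} (hx : 0 ≤ x) (hcc : 0 ≤ c) (hxK : Real.log ((F.g K) ^ 2)⁻¹ ≤ x) (hcK : (F.g K) ^ 2 * β' ≤ c)
    {Nsz : ℕ} (hNsz : 64 ≤ Nsz) (Clean : ℕ → Dom → ℕ → ℕ → Prop)
    (hhost : ∀ j ∈ Icc (jlogOf C K) K, ∀ Z ∈ Disc j, Young j Z → Hosts (G j Z) (birth j Z) j Nsz Rw (Clean j Z))
    (hyb : ∀ j ∈ Icc (jlogOf C K) K, ∀ Z ∈ Disc j, Young j Z → BankYoung₂ (G j Z) ce cs p₀ C' K)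
    (hsizeA : ∀ j ∈ Icc (jlogOf C K) K, ∀ Z ∈ Disc j, ¬Young j Z →
      ‖wA j Z‖ ≤ ρ ^ ageCut C' K * (A * Real.exp (-(R * d j Z))))
    (hsizeB : ∀ j ∈ Icc (jlogOf C K) K, ∀ Z ∈ Disc j, ¬Young j Z →
      ‖wB j Z‖ ≤ ρ ^ ageCut C' K * (A * Real.exp (-(R * d j Z))))
    (h126 : ∀ j, Ineq126 (Cat j) (out j) (d j) κ₀ K₀) (hvol : ∀ j, VolBound (Cat j) (out j) (d j) c₁)
    (hrate' : κ₀ + (r₁ + s) + τ * c₁ ≤ R) (hsmall : A * Real.exp (b + τ * c₁) * K₀ * ν ≤ τ)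
    {Qy Qo : ℕ → Finset Cube}
    (hQy : ∀ j ∈ Icc (jlogOf C K) K, ∀ Z ∈ Disc j, Young j Z → ∃ q ∈ Qy j, q ∈ out j Z)
    (hQo : ∀ j ∈ Icc (jlogOf C K) K, ∀ Z ∈ Disc j, ¬Young j Z → ∃ q ∈ Qo j, q ∈ out j Z)
    (hQyc : ∀ j ∈ Icc (jlogOf C K) K, ((Qy j).card : ℝ) ≤ vol * Λ ^ (K - j))
    (hQoc : ∀ j ∈ Icc (jlogOf C K) K, ((Qo j).card : ℝ) ≤ vol * Λ ^ (K - j))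
    {ιL O : Type*} [DecidableEq ιL] {t : Ledger ιL O} (hnd : t.leaves.Nodup) (rem : ℕ → Finset ιL)
    {dom : ιL → Finset Cube} (hinj : ∀ j, Set.InjOn dom ↑(rem j)) :
    StepBudget C C' θ ρ (A * Real.exp (b + τ * c₁) * K₀) Cr vol Λ
      (T4BankAgeYoung.youngWindow dd L₁ r (T4EpochSize.modelC dd) C' x c) K
      (fun j => t.leafSum fun i => if i ∈ rem j then
        ‖locR ι (Cat j) (cubes j) (wA j) (dom i) - locR ι (Cat j) (cubes j) (wB j) (dom i)‖ else 0)
      (fun j => Cr * θ ^ j * θ⁻¹ ^ T4BankAgeYoung.youngWindow dd L₁ r (T4EpochSize.modelC dd) C' x c K)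
      (fun j => ((Qy j).card : ℝ)) (fun j => ((Qo j).card : ℝ)) :=
  T4MatchingClosureBirth.stepBudget_of_twoRun_geometric ι hθ hθ1 hCr hDisc hloc hreach hd hA hK₀ hτ hρ hr₁ hs hb hwAΛ
    hwBΛ hwA hwB hzero Young birth hbirth hdd G
    (fun j hj Z hZ hY => (hhost j hj Z hZ hY).geometric) (fun j hj Z hZ hY => (hhost j hj Z hZ hY).founded₀)
    (fun j hj Z hZ hY => (hhost j hj Z hZ hY).consumed_alive) (D := fun j Z => 2 * Dceil (G j Z))
    (fun j _ Z _ _ => Dtot₂_le_two_Dceil (G j Z)) (bk := fun j Z => bank₂ (G j Z) ce cs p₀) hce hp hP5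
    (fun j _ Z _ _ => hbk_bank₂ (G j Z) ce cs p₀) hyb F hβ' hL hpos hle1 hrg hub Rw hRj hx hcc hxK hcK
    (st := fun j Z i => epochStart (G j Z) (birth j Z) i)
    (fun j hj Z hZ hY => (hhost j hj Z hZ hY).metAt.hst (Finset.mem_Icc.1 hj).2) hNsz Clean
    (fun j hj Z hZ hY => (hhost j hj Z hZ hY).clean) (fun j hj Z hZ hY => (hhost j hj Z hZ hY).stop)
    (fun j hj Z hZ hY => (hhost j hj Z hZ hY).metAt.hcover)
    hsizeA hsizeB h126 hvol hrate' hsmall hQy hQo hQyc hQoc hnd rem hinj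

/-- **`StepBudget` AT THE CANONICAL YOUNG WINDOW WITH THE AGE PREDICATE DEFINED AS BANK-YOUNGNESS**
(`stepBudget_of_twoRun_hosts` at `Young j Z := BankYoung₂ (G j Z) c_e c_s p̄₀ C′ K`, `hyb := id`): the young side asks,
per bank-young discrepant polymer, the birth-step two-run rate (`hbirth`), a hosting (`hhost`) and an anchoring cube
(`hQy`); the OLD side's binders `hsizeA`, `hsizeB`, `hQo` are keyed to `¬BankYoung₂`, i.e. to «bank₂ ≥ c_e p̄₀·ageCut C′ K»
(`not_bankYoung₂_iff`; NE7b-rem §0 (a)'s hypothesis shape, module docstring (iii)).  Decidability of the age predicate is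
classical (the conclusion does not mention it). [folklore] -/
theorem stepBudget_of_twoRun_bankYoung [Fintype Dom] [Std.Refl ι] [Std.Symm ι]
    {C C' θ ρ Cr vol Λ : ℝ} {K : ℕ} (hθ : 0 < θ) (hθ1 : θ ≤ 1) (hCr : 0 ≤ Cr)
    {Cat Disc : ℕ → Finset Dom} (hDisc : ∀ j, Disc j ⊆ Cat j)
    {cubes out reach : ℕ → Dom → Finset Cube} {d : ℕ → Dom → ℝ} {wA wB : ℕ → Dom → ℂ}
    {A R r₁ s κ₀ K₀ c₁ b τ ν : ℝ}
    (hloc : ∀ j Z, ∀ Z' ∈ Cat j, ι Z' Z → ∃ q ∈ reach j Z, q ∈ out j Z')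
    (hreach : ∀ j Z, ((reach j Z).card : ℝ) ≤ ν * (out j Z).card)
    (hd : ∀ j Z, 0 ≤ d j Z) (hA : 0 ≤ A) (hK₀ : 0 ≤ K₀) (hτ : 0 ≤ τ) (hρ : 0 ≤ ρ)
    (hr₁ : 0 ≤ r₁) (hs : 0 ≤ s) (hb : 0 ≤ b)
    (hwAΛ : ∀ j Z, Z ∉ Cat j → wA j Z = 0) (hwBΛ : ∀ j Z, Z ∉ Cat j → wB j Z = 0)
    (hwA : ∀ j Z, ‖wA j Z‖ ≤ A * Real.exp (-(R * d j Z)))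
    (hwB : ∀ j Z, ‖wB j Z‖ ≤ A * Real.exp (-(R * d j Z)))
    (hzero : ∀ j, ∀ Z ∈ Cat j, Z ∉ Disc j → wA j Z = wB j Z)
    (hdd : 1 ≤ dd) (G : ℕ → Dom → T4GeometricLedger.GeoLedger dd κ η)
    {ce cs p₀ : ℝ} (hce : 0 < ce) (hp : 0 < p₀) (hP5 : ce ≤ cs * p₀) (birth : ℕ → Dom → ℕ)
    (hbirth : ∀ j ∈ Icc (jlogOf C K) K, ∀ Z ∈ Disc j, BankYoung₂ (G j Z) ce cs p₀ C' K →
      ‖wA j Z - wB j Z‖ ≤ Cr * θ ^ birth j Z * (A * Real.exp (-(R * d j Z))))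
    (F : Flow) {β' : ℝ} (hβ' : 0 ≤ β') {L₁ r : ℕ} (hL : 1 ≤ L₁)
    (hpos : ∀ j, j ≤ K → 0 < F.g j) (hle1 : ∀ j, j ≤ K → F.g j ≤ 1) (hrg : F.SatisfiesRG K)
    (hub : ∀ j, j < K → F.β (j + 1) (F.g j) ≤ β') (Rw : ℕ → ℕ)
    (hRj : ∀ j, j ≤ K → B14.IsRj L₁ r (F.g j) (Rw j))
    {x c : ℝ} (hx : 0 ≤ x) (hcc : 0 ≤ c) (hxK : Real.log ((F.g K) ^ 2)⁻¹ ≤ x) (hcK : (F.g K) ^ 2 * β' ≤ c)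
    {Nsz : ℕ} (hNsz : 64 ≤ Nsz) (Clean : ℕ → Dom → ℕ → ℕ → Prop)
    (hhost : ∀ j ∈ Icc (jlogOf C K) K, ∀ Z ∈ Disc j, BankYoung₂ (G j Z) ce cs p₀ C' K →
      Hosts (G j Z) (birth j Z) j Nsz Rw (Clean j Z))
    (hsizeA : ∀ j ∈ Icc (jlogOf C K) K, ∀ Z ∈ Disc j, ¬BankYoung₂ (G j Z) ce cs p₀ C' K →
      ‖wA j Z‖ ≤ ρ ^ ageCut C' K * (A * Real.exp (-(R * d j Z))))
    (hsizeB : ∀ j ∈ Icc (jlogOf C K) K, ∀ Z ∈ Disc j, ¬BankYoung₂ (G j Z) ce cs p₀ C' K →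
      ‖wB j Z‖ ≤ ρ ^ ageCut C' K * (A * Real.exp (-(R * d j Z))))
    (h126 : ∀ j, Ineq126 (Cat j) (out j) (d j) κ₀ K₀) (hvol : ∀ j, VolBound (Cat j) (out j) (d j) c₁)
    (hrate' : κ₀ + (r₁ + s) + τ * c₁ ≤ R) (hsmall : A * Real.exp (b + τ * c₁) * K₀ * ν ≤ τ)
    {Qy Qo : ℕ → Finset Cube}
    (hQy : ∀ j ∈ Icc (jlogOf C K) K, ∀ Z ∈ Disc j, BankYoung₂ (G j Z) ce cs p₀ C' K → ∃ q ∈ Qy j, q ∈ out j Z)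
    (hQo : ∀ j ∈ Icc (jlogOf C K) K, ∀ Z ∈ Disc j, ¬BankYoung₂ (G j Z) ce cs p₀ C' K → ∃ q ∈ Qo j, q ∈ out j Z)
    (hQyc : ∀ j ∈ Icc (jlogOf C K) K, ((Qy j).card : ℝ) ≤ vol * Λ ^ (K - j))
    (hQoc : ∀ j ∈ Icc (jlogOf C K) K, ((Qo j).card : ℝ) ≤ vol * Λ ^ (K - j))
    {ιL O : Type*} [DecidableEq ιL] {t : Ledger ιL O} (hnd : t.leaves.Nodup) (rem : ℕ → Finset ιL)
    {dom : ιL → Finset Cube} (hinj : ∀ j, Set.InjOn dom ↑(rem j)) :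
    StepBudget C C' θ ρ (A * Real.exp (b + τ * c₁) * K₀) Cr vol Λ
      (T4BankAgeYoung.youngWindow dd L₁ r (T4EpochSize.modelC dd) C' x c) K
      (fun j => t.leafSum fun i => if i ∈ rem j then
        ‖locR ι (Cat j) (cubes j) (wA j) (dom i) - locR ι (Cat j) (cubes j) (wB j) (dom i)‖ else 0)
      (fun j => Cr * θ ^ j * θ⁻¹ ^ T4BankAgeYoung.youngWindow dd L₁ r (T4EpochSize.modelC dd) C' x c K)
      (fun j => ((Qy j).card : ℝ)) (fun j => ((Qo j).card : ℝ)) := by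
  classical
  exact stepBudget_of_twoRun_hosts ι hθ hθ1 hCr hDisc hloc hreach hd hA hK₀ hτ hρ hr₁ hs hb hwAΛ hwBΛ hwA hwB hzero
    (fun j Z => BankYoung₂ (G j Z) ce cs p₀ C' K) birth hbirth hdd G hce hp hP5 F hβ' hL hpos hle1 hrg hub Rw hRj hx
    hcc hxK hcK hNsz Clean hhost (fun _ _ _ _ h => h) hsizeA hsizeB h126 hvol hrate' hsmall hQy hQo hQyc hQoc hnd rem
    hinj

/-- **THE EXISTENTIAL FEED WITH THE AGE PREDICATE DEFINED AS BANK-YOUNGNESS**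
(`…T4MatchingClosureBirth.steps_feed_of_twoRun_geometric` in ONE application at `Young j Z := BankYoung₂ (G j Z) …`, the
per-polymer producer binders replaced by `hhost`): the per-term binder `hsteps` of
`…T4MatchingClosureYoung.hybridNE7_closure_fed_steps_youngWindow` / `stringHybridNE7_closure_fed_steps_youngWindow`
inhabited from birth-step two-run data on the bank-young discrepant polymers, their hostings, and the old-born size on the
others. [folklore] -/
theorem steps_feed_of_twoRun_bankYoung [Fintype Dom] [Std.Refl ι] [Std.Symm ι]
    {C C' θ ρ Cr vol Λ : ℝ} {K : ℕ} (hθ : 0 < θ) (hθ1 : θ ≤ 1) (hCr : 0 ≤ Cr)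
    {Cat Disc : ℕ → Finset Dom} (hDisc : ∀ j, Disc j ⊆ Cat j)
    {cubes out reach : ℕ → Dom → Finset Cube} {d : ℕ → Dom → ℝ} {wA wB : ℕ → Dom → ℂ}
    {A R r₁ s κ₀ K₀ c₁ b τ ν : ℝ}
    (hloc : ∀ j Z, ∀ Z' ∈ Cat j, ι Z' Z → ∃ q ∈ reach j Z, q ∈ out j Z')
    (hreach : ∀ j Z, ((reach j Z).card : ℝ) ≤ ν * (out j Z).card)
    (hd : ∀ j Z, 0 ≤ d j Z) (hA : 0 ≤ A) (hK₀ : 0 ≤ K₀) (hτ : 0 ≤ τ) (hρ : 0 ≤ ρ)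
    (hr₁ : 0 ≤ r₁) (hs : 0 ≤ s) (hb : 0 ≤ b)
    (hwAΛ : ∀ j Z, Z ∉ Cat j → wA j Z = 0) (hwBΛ : ∀ j Z, Z ∉ Cat j → wB j Z = 0)
    (hwA : ∀ j Z, ‖wA j Z‖ ≤ A * Real.exp (-(R * d j Z)))
    (hwB : ∀ j Z, ‖wB j Z‖ ≤ A * Real.exp (-(R * d j Z)))
    (hzero : ∀ j, ∀ Z ∈ Cat j, Z ∉ Disc j → wA j Z = wB j Z)
    (hdd : 1 ≤ dd) (G : ℕ → Dom → T4GeometricLedger.GeoLedger dd κ η)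
    {ce cs p₀ : ℝ} (hce : 0 < ce) (hp : 0 < p₀) (hP5 : ce ≤ cs * p₀) (birth : ℕ → Dom → ℕ)
    (hbirth : ∀ j ∈ Icc (jlogOf C K) K, ∀ Z ∈ Disc j, BankYoung₂ (G j Z) ce cs p₀ C' K →
      ‖wA j Z - wB j Z‖ ≤ Cr * θ ^ birth j Z * (A * Real.exp (-(R * d j Z))))
    (F : Flow) {β' : ℝ} (hβ' : 0 ≤ β') {L₁ r : ℕ} (hL : 1 ≤ L₁)
    (hpos : ∀ j, j ≤ K → 0 < F.g j) (hle1 : ∀ j, j ≤ K → F.g j ≤ 1) (hrg : F.SatisfiesRG K)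
    (hub : ∀ j, j < K → F.β (j + 1) (F.g j) ≤ β') (Rw : ℕ → ℕ)
    (hRj : ∀ j, j ≤ K → B14.IsRj L₁ r (F.g j) (Rw j))
    {x c : ℝ} (hx : 0 ≤ x) (hcc : 0 ≤ c) (hxK : Real.log ((F.g K) ^ 2)⁻¹ ≤ x) (hcK : (F.g K) ^ 2 * β' ≤ c)
    {Nsz : ℕ} (hNsz : 64 ≤ Nsz) (Clean : ℕ → Dom → ℕ → ℕ → Prop)
    (hhost : ∀ j ∈ Icc (jlogOf C K) K, ∀ Z ∈ Disc j, BankYoung₂ (G j Z) ce cs p₀ C' K →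
      Hosts (G j Z) (birth j Z) j Nsz Rw (Clean j Z))
    (hsizeA : ∀ j ∈ Icc (jlogOf C K) K, ∀ Z ∈ Disc j, ¬BankYoung₂ (G j Z) ce cs p₀ C' K →
      ‖wA j Z‖ ≤ ρ ^ ageCut C' K * (A * Real.exp (-(R * d j Z))))
    (hsizeB : ∀ j ∈ Icc (jlogOf C K) K, ∀ Z ∈ Disc j, ¬BankYoung₂ (G j Z) ce cs p₀ C' K →
      ‖wB j Z‖ ≤ ρ ^ ageCut C' K * (A * Real.exp (-(R * d j Z))))
    (h126 : ∀ j, Ineq126 (Cat j) (out j) (d j) κ₀ K₀) (hvol : ∀ j, VolBound (Cat j) (out j) (d j) c₁)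
    (hrate' : κ₀ + (r₁ + s) + τ * c₁ ≤ R) (hsmall : A * Real.exp (b + τ * c₁) * K₀ * ν ≤ τ)
    {Qy Qo : ℕ → Finset Cube}
    (hQy : ∀ j ∈ Icc (jlogOf C K) K, ∀ Z ∈ Disc j, BankYoung₂ (G j Z) ce cs p₀ C' K → ∃ q ∈ Qy j, q ∈ out j Z)
    (hQo : ∀ j ∈ Icc (jlogOf C K) K, ∀ Z ∈ Disc j, ¬BankYoung₂ (G j Z) ce cs p₀ C' K → ∃ q ∈ Qo j, q ∈ out j Z)
    (hQyc : ∀ j ∈ Icc (jlogOf C K) K, ((Qy j).card : ℝ) ≤ vol * Λ ^ (K - j))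
    (hQoc : ∀ j ∈ Icc (jlogOf C K) K, ((Qo j).card : ℝ) ≤ vol * Λ ^ (K - j))
    {ιL O : Type*} [DecidableEq ιL] {t : Ledger ιL O} (hnd : t.leaves.Nodup) (rem : ℕ → Finset ιL)
    {dom : ιL → Finset Cube} (hinj : ∀ j, Set.InjOn dom ↑(rem j)) {RrRem : ℝ}
    (hRem : RrRem ≤ ∑ j ∈ Icc (jlogOf C K) K, t.leafSum fun i => if i ∈ rem j then
      ‖locR ι (Cat j) (cubes j) (wA j) (dom i) - locR ι (Cat j) (cubes j) (wB j) (dom i)‖ else 0) :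
    ∃ rad ry Qy' Qo' : ℕ → ℝ,
      StepBudget C C' θ ρ (A * Real.exp (b + τ * c₁) * K₀) Cr vol Λ
          (T4BankAgeYoung.youngWindow dd L₁ r (T4EpochSize.modelC dd) C' x c) K rad ry Qy' Qo' ∧
        RrRem ≤ ∑ j ∈ Icc (jlogOf C K) K, rad j := by
  classical
  exact T4MatchingClosureBirth.steps_feed_of_twoRun_geometric ι hθ hθ1 hCr hDisc hloc hreach hd hA hK₀ hτ hρ hr₁ hs hb
    hwAΛ hwBΛ hwA hwB hzero (fun j Z => BankYoung₂ (G j Z) ce cs p₀ C' K) birth hbirth hdd G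
    (fun j hj Z hZ hY => (hhost j hj Z hZ hY).geometric) (fun j hj Z hZ hY => (hhost j hj Z hZ hY).founded₀)
    (fun j hj Z hZ hY => (hhost j hj Z hZ hY).consumed_alive) (D := fun j Z => 2 * Dceil (G j Z))
    (fun j _ Z _ _ => Dtot₂_le_two_Dceil (G j Z)) (bk := fun j Z => bank₂ (G j Z) ce cs p₀) hce hp hP5
    (fun j _ Z _ _ => hbk_bank₂ (G j Z) ce cs p₀) (fun _ _ _ _ h => h) F hβ' hL hpos hle1 hrg hub Rw hRj hx hcc hxK hcK
    (st := fun j Z i => epochStart (G j Z) (birth j Z) i)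
    (fun j hj Z hZ hY => (hhost j hj Z hZ hY).metAt.hst (Finset.mem_Icc.1 hj).2) hNsz Clean
    (fun j hj Z hZ hY => (hhost j hj Z hZ hY).clean) (fun j hj Z hZ hY => (hhost j hj Z hZ hY).stop)
    (fun j hj Z hZ hY => (hhost j hj Z hZ hY).metAt.hcover)
    hsizeA hsizeB h126 hvol hrate' hsmall hQy hQo hQyc hQoc hnd rem hinj hRem

end WindowTwoRun

/-! ## §A The undoubled booking: Lemma Y end to end with (P5₂), and the bank-young hosting form -/

section Undoubled

open B13ScaleTransfer TreeLength B16SProfile B16StoppingRule T4GeometricLedger T4RemnantBooking T4BankAgeYoung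
  T4EpochHorizon

variable {d : ℕ} {κ ι : Type*} (G : GeoLedger d κ ι)

/-- The epoch-start sizes `σ` of the UNDOUBLED numerical ledger ARE the model sizes of the epoch bases' domains (the
`toLedger` twin of `…T4GeometricLedger.GeoLedger.treeLen_dom_base_le_σ`, with equality). [folklore] -/
theorem treeLen_dom_base_le_σ₁ : ∀ i, i ≤ G.E → treeLen (G.dom (G.base i)) ≤ G.toLedger.σ i
  | 0, _ => le_of_eq rfl
  | e + 1, he => by
    rw [T4Genealogy.Ledger.σ_succ_of_lt _ (show e < G.toLedger.E from he)]
    exact le_of_eq rfl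

/-- The cover profiles of the epoch bases discharge `hint` and `hhalf` of Lemma Y on the UNDOUBLED ledger (twin of
`…T4EpochHorizon.coverProfile_binders`). [folklore] -/
theorem coverProfile_binders₁ (hG : G.Geometric) :
    (∀ i, i ≤ G.E → ∀ k,
      0 < T4EpochSize.coverProfile G.L (G.expo (G.base i)) (G.steps (G.base i)) (G.dom (G.base i)) k →
        1 ≤ T4EpochSize.coverProfile G.L (G.expo (G.base i)) (G.steps (G.base i)) (G.dom (G.base i)) k) ∧
    (∀ i, i ≤ G.E → ∀ k, 1 < k →
      T4EpochSize.coverProfile G.L (G.expo (G.base i)) (G.steps (G.base i)) (G.dom (G.base i)) k ≤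
        (1 / 2) ^ k * G.toLedger.σ i) := by
  refine ⟨fun i _ => T4EpochSize.coverProfile_int _, fun i hi k hk => ?_⟩
  exact (T4EpochSize.coverProfile_halving hG.four_le (hG.drop _) (hG.dom_nonempty _) (hG.dom_conn _) k hk).trans
    (mul_le_mul_of_nonneg_left (treeLen_dom_base_le_σ₁ G i hi) (by positivity))

variable [DecidableEq κ] [DecidableEq ι]

/-- **LEMMA Y FOR A GEOMETRIC LEDGER, END TO END, ON THE UNDOUBLED BOOKING**
(`…T4GenealogyLifetime.lifetime_lt_of_ledger_cover_four G.toLedger …` with `wf_of_geometric`, `hfnd_of_geometric`,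
`hev_of_geometric`, `treeLen_dom_base_le_σ₁` BY NAME): as `…T4GeometricLedger.GeoLedger.lifetime_lt_of_geometric`, with
the credit reading `Dtot ≤ D` UNDOUBLED and (P5₂) `2·c_e ≤ c_s·p̄₀` in place of (P5) — the factor `2` of the model's new-part
constant `4·14^d` carried by the constant inequality instead of the booking. [folklore] -/
theorem lifetime_lt_of_geometric_four (hG : G.Geometric) (h0 : G.base₀ ∈ G.founded 0)
    (hc : ∀ e, e < G.E → G.consumed e ⊆ G.toLedger.alive e) (hd : 1 ≤ d)
    {D A : ℕ} (hDD : G.toLedger.Dtot ≤ (D : ℝ))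
    {ce cs p₀ b : ℝ} (hce : 0 < ce) (hp : 0 < p₀) (hP5₂ : 2 * ce ≤ cs * p₀)
    (hb : ce * p₀ * G.E + cs * p₀ ^ 2 * D ≤ b) (hbA : b < ce * p₀ * A)
    {R : ℕ → ℝ} {Rmax : ℝ} (hRmax : 0 ≤ Rmax) (hR : ∀ i, i ≤ G.E → R i ≤ Rmax)
    (hlen : ∀ i, i ≤ G.E → ∃ k : ℕ,
      (k = 0 ∨ 0 < T4EpochSize.coverProfile G.L (G.expo (G.base i)) (G.steps (G.base i)) (G.dom (G.base i)) k) ∧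
        ((G.steps (G.base i) : ℕ) : ℝ) ≤ k + R i) :
    (∑ i ∈ Finset.range (G.E + 1), ((G.steps (G.base i) : ℕ) : ℝ)) <
      A * T4BankAgeYoung.epochAllowance d (T4EpochSize.modelC d) Rmax A :=
  T4GenealogyLifetime.lifetime_lt_of_ledger_cover_four G.toLedger (G.wf_of_geometric hG h0 hc)
    (T4EpochSize.one_le_modelC d) hd (G.hfnd_of_geometric hG) (G.hev_of_geometric hG) (m := G.E) le_rfl hDD hce hp hP5₂
    hb hbA hG.four_le (sc := fun i => G.expo (G.base i)) (hor := fun i => G.steps (G.base i))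
    (fun i _ => hG.drop (G.base i)) (Z := fun i => G.dom (G.base i)) (fun i _ => hG.dom_nonempty (G.base i))
    (fun i _ => hG.dom_conn (G.base i)) (treeLen_dom_base_le_σ₁ G) hRmax (len := fun i => G.steps (G.base i)) hlen hR

/-- **THE LINK (Y3) ON A GEOMETRIC LEDGER, HORIZON DISCHARGED, ON THE UNDOUBLED BOOKING**
(`…T4GenealogyLifetime.lifetime_lt_youngWindow_of_ledger_four` ∘ `coverProfile_binders₁` ∘ `…T4EpochHorizon.horizon`; twin
of `…T4EpochHorizon.lifetime_lt_youngWindow_of_geometric_stopping` with `Dtot ≤ D` and (P5₂)). [folklore] -/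
theorem lifetime_lt_youngWindow_of_geometric_stopping_four (hG : G.Geometric)
    (h0 : G.base₀ ∈ G.founded 0) (hc : ∀ e, e < G.E → G.consumed e ⊆ G.toLedger.alive e) (hd : 1 ≤ d)
    {D : ℕ} {C' : ℝ} {K : ℕ} (hDD : G.toLedger.Dtot ≤ (D : ℝ))
    {ce cs p₀ b : ℝ} (hce : 0 < ce) (hp : 0 < p₀) (hP5₂ : 2 * ce ≤ cs * p₀)
    (hb : ce * p₀ * G.E + cs * p₀ ^ 2 * D ≤ b) (hbA : b < ce * p₀ * (T4RemnantBooking.ageCut C' K))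
    (F : Flow) {β' : ℝ} (hβ' : 0 ≤ β') {L₁ r : ℕ} (hL : 1 ≤ L₁)
    (hpos : ∀ j, j ≤ K → 0 < F.g j) (hle1 : ∀ j, j ≤ K → F.g j ≤ 1) (hrg : F.SatisfiesRG K)
    (hub : ∀ j, j < K → F.β (j + 1) (F.g j) ≤ β') (R : ℕ → ℕ) (hRj : ∀ j, j ≤ K → B14.IsRj L₁ r (F.g j) (R j))
    {x c : ℝ} (hx : 0 ≤ x) (hcc : 0 ≤ c) (hxK : Real.log ((F.g K) ^ 2)⁻¹ ≤ x) (hcK : (F.g K) ^ 2 * β' ≤ c)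
    {s : ℕ → ℕ} (hs : ∀ i, i ≤ G.E → s i ≤ K)
    {Nsz : ℕ} (hNsz : 64 ≤ Nsz) (Clean : ℕ → ℕ → Prop)
    (hclean : ∀ i, i ≤ G.E → ∀ l, 1 ≤ l → l ≤ G.steps (G.base i) → Clean i l)
    (hstop : ∀ i, i ≤ G.E → ∀ K', K' ≤ G.steps (G.base i) →
      StopAt Nsz (R (s i)) (Clean i) (fun n => Siter (ratio G.L (G.expo (G.base i))) n (G.dom (G.base i))) K' →
        G.steps (G.base i) ≤ K') :
    (∑ i ∈ Finset.range (G.E + 1), ((G.steps (G.base i) : ℕ) : ℝ)) <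
        T4BankAgeYoung.youngAllowance d L₁ r (T4EpochSize.modelC d) C' x c K ∧
      (∑ i ∈ Finset.range (G.E + 1), ((G.steps (G.base i) : ℕ) : ℝ)) <
        (T4BankAgeYoung.youngWindow d L₁ r (T4EpochSize.modelC d) C' x c K : ℝ) := by
  have hL3 : 3 ≤ G.L := le_trans (by norm_num) hG.four_le
  obtain ⟨hint, hhalf⟩ := coverProfile_binders₁ G hG
  exact T4GenealogyLifetime.lifetime_lt_youngWindow_of_ledger_four G.toLedger (G.wf_of_geometric hG h0 hc)
    (T4EpochSize.one_le_modelC d) hd (G.hfnd_of_geometric hG) (G.hev_of_geometric hG) (m := G.E) le_rfl hDD hce hp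
    hP5₂ hb hbA (len := fun i => G.steps (G.base i)) hint hhalf F hβ' hL hpos hle1 hrg hub R hRj hx hcc hxK hcK hs
    fun i hi => horizon hL3 (hG.drop (G.base i)) (hG.dom_nonempty _) (hG.dom_conn _) hNsz
      (one_le_of_isRj hL (hRj (s i) (hs i hi))) (Clean i) (hclean i hi) le_rfl (hstop i hi)

/-- **THE WINDOW CLAUSE OF ONE HOSTED BANK-YOUNG POLYMER ON THE UNDOUBLED BOOKING** (`BankYoung`, i.e. the bank of record
§2 D1 itself below the age-cut credit; (P5₂) `2·c_e ≤ c_s·p̄₀`): `j ≤ b + youngWindow d L₁ r (modelC d) C′ x̄ c̄ K`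
(`…T4MatchingClosureYoung.step_le_birth_add_window` ∘ `lifetime_lt_youngWindow_of_geometric_stopping_four`). [folklore] -/
theorem step_le_birth_add_youngWindow_of_hosts_four {G : GeoLedger d κ ι} {b j Nsz : ℕ} {Rw : ℕ → ℕ}
    {Clean : ℕ → ℕ → Prop} (h : Hosts G b j Nsz Rw Clean) (hd : 1 ≤ d) {K : ℕ} (hjK : j ≤ K)
    {ce cs p₀ C' : ℝ} (hce : 0 < ce) (hp : 0 < p₀) (hP5₂ : 2 * ce ≤ cs * p₀) (hy : BankYoung G ce cs p₀ C' K)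
    (F : Flow) {β' : ℝ} (hβ' : 0 ≤ β') {L₁ r : ℕ} (hL : 1 ≤ L₁)
    (hpos : ∀ j, j ≤ K → 0 < F.g j) (hle1 : ∀ j, j ≤ K → F.g j ≤ 1) (hrg : F.SatisfiesRG K)
    (hub : ∀ j, j < K → F.β (j + 1) (F.g j) ≤ β') (hRj : ∀ j, j ≤ K → B14.IsRj L₁ r (F.g j) (Rw j))
    {x c : ℝ} (hx : 0 ≤ x) (hcc : 0 ≤ c) (hxK : Real.log ((F.g K) ^ 2)⁻¹ ≤ x) (hcK : (F.g K) ^ 2 * β' ≤ c)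
    (hNsz : 64 ≤ Nsz) :
    j ≤ b + youngWindow d L₁ r (T4EpochSize.modelC d) C' x c K :=
  T4MatchingClosureYoung.step_le_birth_add_window h.metAt.hcover
    (lifetime_lt_youngWindow_of_geometric_stopping_four G h.geometric h.founded₀ h.consumed_alive hd (Dtot_le_Dceil G)
      hce hp hP5₂ (hbk_bank G ce cs p₀) hy F hβ' hL hpos hle1 hrg hub Rw hRj hx hcc hxK hcK (h.metAt.hst hjK) hNsz
      Clean h.clean h.stop).2

/-- **THE YOUNG RATE OF ONE HOSTED BANK-YOUNG POLYMER ON THE UNDOUBLED BOOKING** (`BankYoung`, (P5₂); `0 < θ ≤ 1`,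
`0 ≤ C_r`): `C_r·θ^b ≤ C_r·θ^j·θ^{−youngWindow d L₁ r (modelC d) C′ x̄ c̄ K}`
(`…T4MatchingClosureYoung.youngRate_of_lifetime_lt` ∘ `lifetime_lt_youngWindow_of_geometric_stopping_four`). [folklore] -/
theorem youngRate_of_hosts_four {θ : ℝ} (hθ : 0 < θ) (hθ1 : θ ≤ 1) {Cr : ℝ} (hCr : 0 ≤ Cr)
    {G : GeoLedger d κ ι} {b j Nsz : ℕ} {Rw : ℕ → ℕ}
    {Clean : ℕ → ℕ → Prop} (h : Hosts G b j Nsz Rw Clean) (hd : 1 ≤ d) {K : ℕ} (hjK : j ≤ K)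
    {ce cs p₀ C' : ℝ} (hce : 0 < ce) (hp : 0 < p₀) (hP5₂ : 2 * ce ≤ cs * p₀) (hy : BankYoung G ce cs p₀ C' K)
    (F : Flow) {β' : ℝ} (hβ' : 0 ≤ β') {L₁ r : ℕ} (hL : 1 ≤ L₁)
    (hpos : ∀ j, j ≤ K → 0 < F.g j) (hle1 : ∀ j, j ≤ K → F.g j ≤ 1) (hrg : F.SatisfiesRG K)
    (hub : ∀ j, j < K → F.β (j + 1) (F.g j) ≤ β') (hRj : ∀ j, j ≤ K → B14.IsRj L₁ r (F.g j) (Rw j))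
    {x c : ℝ} (hx : 0 ≤ x) (hcc : 0 ≤ c) (hxK : Real.log ((F.g K) ^ 2)⁻¹ ≤ x) (hcK : (F.g K) ^ 2 * β' ≤ c)
    (hNsz : 64 ≤ Nsz) :
    Cr * θ ^ b ≤ Cr * θ ^ j * θ⁻¹ ^ youngWindow d L₁ r (T4EpochSize.modelC d) C' x c K :=
  T4MatchingClosureYoung.youngRate_of_lifetime_lt hθ hθ1 hCr (W := youngWindow d L₁ r (T4EpochSize.modelC d) C' x c)
    h.metAt.hcover
    (lifetime_lt_youngWindow_of_geometric_stopping_four G h.geometric h.founded₀ h.consumed_alive hd (Dtot_le_Dceil G)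
      hce hp hP5₂ (hbk_bank G ce cs p₀) hy F hβ' hL hpos hle1 hrg hub Rw hRj hx hcc hxK hcK (h.metAt.hst hjK) hNsz
      Clean h.clean h.stop).2

end Undoubled

/-! ## §5 Non-vacuity (`d = 1`): the test ledger `geoEx` hosts a polymer met at its birth step and is bank-young -/

section NonVacuity

open B13ScaleTransfer TreeLength B16SProfile B16StoppingRule T4GeometricLedger T4RemnantBooking T4BankAgeYoung
  T4EpochHorizon T4MatchingClosureBirth

/-- All epochs of `geoEx` start at the birth step (all step counts are `0`). [folklore] -/
theorem epochStart_geoEx (b i : ℕ) : epochStart geoEx b i = b := by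
  simp [epochStart, geoEx]

/-- A polymer met at the birth step of `geoEx` is met during its last (length-`0`) epoch. [folklore] -/
theorem metAt_geoEx (b : ℕ) : MetAt geoEx b b := by
  refine ⟨(epochStart_geoEx b _).le, ?_⟩
  rw [epochStart_geoEx]
  exact Nat.le_add_right _ _

/-- `geoEx` HOSTS a polymer met at its birth step, with `Nsz = 64`, windows `Rw ≡ 1`, everything clean (the stopping
reading holds trivially for epochs of length `0`). [folklore] -/
theorem hosts_geoEx (b : ℕ) : Hosts geoEx b b 64 (fun _ => 1) (fun _ _ => True) where
  geometric := geoEx_geometric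
  founded₀ := by simp [geoEx]
  consumed_alive e he := by
    have he0 : e = 0 := by simp only [geoEx] at he; omega
    subst he0
    simp [geoEx, GeoLedger.toLedger]
  metAt := metAt_geoEx b
  clean _ _ _ _ _ := trivial
  stop i _ K' _ _ := by simp [geoEx]

/-- `Dtot geoEx = 2` (`Dtot₂ = 4`, `…T4EpochHorizon.geoEx_Dtot₂`, halved by `toLedger₂_Dtot`). [folklore] -/
theorem Dtot_geoEx : geoEx.toLedger.Dtot = 2 := by
  have h2 := toLedger₂_Dtot geoEx
  rw [geoEx_Dtot₂] at h2
  linarith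

/-- `Dceil geoEx = 2`. [folklore] -/
theorem Dceil_geoEx : Dceil geoEx = 2 := by
  rw [Dceil, Dtot_geoEx, show (2 : ℝ) = ((2 : ℕ) : ℝ) by norm_num, Nat.ceil_natCast]

/-- `bank geoEx 1 1 1 = 3`. [folklore] -/
theorem bank_geoEx : bank geoEx 1 1 1 = 3 := by
  rw [bank, Dceil_geoEx]
  norm_num [geoEx]

/-- `bank₂ geoEx 1 1 1 = 5`. [folklore] -/
theorem bank₂_geoEx : bank₂ geoEx 1 1 1 = 5 := by
  rw [bank₂, Dceil_geoEx]
  norm_num [geoEx]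

/-- `bank geoEx 1 2 1 = 5` (the (P5₂) data `c_e = p̄₀ = 1`, `c_s = 2` of §A's application). [folklore] -/
theorem bank_geoEx₂ : bank geoEx 1 2 1 = 5 := by
  rw [bank, Dceil_geoEx]
  norm_num [geoEx]

/-- `geoEx` is `BankYoung₂` at `c_e = c_s = p̄₀ = 1`, `C′ = 10`, `K = 1` (`5 < ⌈10·log 2⌉₊`). [folklore] -/
theorem bankYoung₂_geoEx : BankYoung₂ geoEx 1 1 1 10 1 := by
  rw [BankYoung₂, bank₂_geoEx]
  linarith [six_lt_ageCut_ten_one]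

/-- `geoEx` is `BankYoung` at the same data. [folklore] -/
theorem bankYoung_geoEx : BankYoung geoEx 1 1 1 10 1 :=
  bankYoung_of_bankYoung₂ zero_le_one bankYoung₂_geoEx

/-- `geoEx` is `BankYoung` at the (P5₂) data `c_e = p̄₀ = 1`, `c_s = 2`, `C′ = 10`, `K = 1`. [folklore] -/
theorem bankYoung_geoEx₂ : BankYoung geoEx 1 2 1 10 1 := by
  rw [BankYoung, bank_geoEx₂]
  linarith [six_lt_ageCut_ten_one]

/-- **§3 APPLIED**: `step_le_birth_add_youngWindow_of_hosts` on the hosting `hosts_geoEx 1` (polymer met at step `j = 1 =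
b`) at the cutoff `K = 1`, `C′ = 10`, S-side constants `1`, the FLAT FLOW `g ≡ 1`, `β ≡ 0` with windows `Rw ≡ 1`,
`β′ = x̄ = c̄ = 0`, `L₁ = r = 1`; conclusion `1 ≤ 1 + youngWindow 1 1 1 (modelC 1) 10 0 0 1` (inhabitation of the joint
hypothesis list; nothing about print). [folklore] -/
example : 1 ≤ 1 + youngWindow 1 1 1 (T4EpochSize.modelC 1) 10 0 0 1 :=
  step_le_birth_add_youngWindow_of_hosts (hosts_geoEx 1) le_rfl (K := 1) le_rfl one_pos one_pos (by norm_num)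
    bankYoung₂_geoEx ⟨fun _ => 1, fun _ _ => 0⟩ (β' := 0) le_rfl (L₁ := 1) (r := 1) le_rfl (fun _ _ => one_pos)
    (fun _ _ => le_rfl) (flatFlow_satisfiesRG 1) (fun _ _ => le_rfl) (fun _ _ => isRj_one) (x := 0) (c := 0) le_rfl
    le_rfl (by simp) (by simp) le_rfl

/-- **§3 APPLIED (rate form)**: `youngRate_of_hosts` on the same data, any `0 < θ ≤ 1`, `0 ≤ C_r`. [folklore] -/
example {θ Cr : ℝ} (hθ : 0 < θ) (hθ1 : θ ≤ 1) (hCr : 0 ≤ Cr) :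
    Cr * θ ^ 1 ≤ Cr * θ ^ 1 * θ⁻¹ ^ youngWindow 1 1 1 (T4EpochSize.modelC 1) 10 0 0 1 :=
  youngRate_of_hosts hθ hθ1 hCr (hosts_geoEx 1) le_rfl (K := 1) le_rfl one_pos one_pos (by norm_num)
    bankYoung₂_geoEx ⟨fun _ => 1, fun _ _ => 0⟩ (β' := 0) le_rfl (L₁ := 1) (r := 1) le_rfl (fun _ _ => one_pos)
    (fun _ _ => le_rfl) (flatFlow_satisfiesRG 1) (fun _ _ => le_rfl) (fun _ _ => isRj_one) (x := 0) (c := 0) le_rfl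
    le_rfl (by simp) (by simp) le_rfl

/-- **§A APPLIED**: `step_le_birth_add_youngWindow_of_hosts_four` on the same hosting with (P5₂) at `c_e = p̄₀ = 1`,
`c_s = 2` (`2·1 ≤ 2·1`) and the undoubled bank `bank geoEx 1 2 1 = 1 + 2·2 = 5 < ageCut 10 1`. [folklore] -/
example : 1 ≤ 1 + youngWindow 1 1 1 (T4EpochSize.modelC 1) 10 0 0 1 :=
  step_le_birth_add_youngWindow_of_hosts_four (hosts_geoEx 1) le_rfl (K := 1) le_rfl (ce := 1) (cs := 2) (p₀ := 1)
    one_pos one_pos (by norm_num) bankYoung_geoEx₂ ⟨fun _ => 1, fun _ _ => 0⟩ (β' := 0) le_rfl (L₁ := 1) (r := 1) le_rfl (fun _ _ => one_pos)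
    (fun _ _ => le_rfl) (flatFlow_satisfiesRG 1) (fun _ _ => le_rfl) (fun _ _ => isRj_one) (x := 0) (c := 0) le_rfl
    le_rfl (by simp) (by simp) le_rfl

/-- **§A APPLIED (Lemma Y form)**: `lifetime_lt_of_geometric_four` on `geoEx` with `D = 2 = Dtot`, `c_e = p̄₀ = 1`, `c_s = 2`,
`b = 5 < 1·1·6`, memories `R ≡ 1 = R_max`; conclusion `Σ_{i ≤ 1} 0 < 6·epochAllowance 1 (modelC 1) 1 6`. [folklore] -/
example : (∑ i ∈ Finset.range (geoEx.E + 1), ((geoEx.steps (geoEx.base i) : ℕ) : ℝ)) <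
    ((6 : ℕ) : ℝ) * epochAllowance 1 (T4EpochSize.modelC 1) 1 6 :=
  lifetime_lt_of_geometric_four geoEx geoEx_geometric (by simp [geoEx])
    (fun e he => by
      have he0 : e = 0 := by simp only [geoEx] at he; omega
      subst he0
      simp [geoEx, GeoLedger.toLedger])
    le_rfl (D := 2) (A := 6)
    (by rw [Dtot_geoEx]; norm_num)
    (ce := 1) (cs := 2) (p₀ := 1) (b := 5) one_pos one_pos (by norm_num) (by norm_num [geoEx]) (by norm_num)
    (R := fun _ => 1) (Rmax := 1) zero_le_one (fun _ _ => le_rfl)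
    (fun i _ => ⟨0, Or.inl rfl, by simp [geoEx]⟩)

end NonVacuity

end

end Literature.MathematicalPhysics.QuantumFieldTheory.Balaban1983to89.T4YoungHosting
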